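import Summits.Ventures.PercRepro.RankLevelSet

/-!
# PercRepro — THE BINOMIAL IDENTITIES OF THE TIGHT LAYER (night-1, gen 9; dossier §19.7, part 1 of 2)

With `Φ = phiK`, `n = p + q`, `1 ≤ q`, `q + 2 ≤ p`:

* `phiK_eq_sum_ratio` — `Φ(p,q) = Σ_{q<u<p} C(p,u)/C(n−u,p−u)` (`Nat.choose_mul`);
* `weight_eq` — `Σ_{q<u<p} C(p−1,u)/C(n−u,p−u) + (C(p−1,q) − 1)/C(p−1,q) = Φ(p,q) − Φ(p−1,q) − 1/C(p−1,q)`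
  (Pascal on `C(p,u)`, the reindexed sum is `1 + Φ(p−1,q)`);
* `phiK_mul_eq` — `Φ(p,q)·(p+q) = (2Φ(p−1,q) + 2)·p` (Pascal on `C(n,u)`, mine-2's exact form (R)).

Part 2 (RankLevelSetTightArithB) proves the inequality J(p,q) from these.  Axioms: standard.
-/

namespace PercRepro

open Finset

/-- `C(n,u)/C(n,p) = C(p,u)/C(n−u,p−u)` for `u ≤ p ≤ n`. -/
lemma choose_div_choose_eq {n p u : ℕ} (hup : u ≤ p) (hpn : p ≤ n) :
    ((n.choose u : ℕ) : ℚ) / ((n.choose p : ℕ) : ℚ) =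
      ((p.choose u : ℕ) : ℚ) / (((n - u).choose (p - u) : ℕ) : ℚ) := by
  have h := Nat.choose_mul (n := n) (k := p) (s := u) hup
  have h1 : (0 : ℚ) < ((n.choose p : ℕ) : ℚ) := by exact_mod_cast Nat.choose_pos hpn
  have h2 : (0 : ℚ) < (((n - u).choose (p - u) : ℕ) : ℚ) := by
    exact_mod_cast Nat.choose_pos (by omega)
  rw [div_eq_div_iff h1.ne' h2.ne']
  have h' : ((n.choose p : ℕ) : ℚ) * ((p.choose u : ℕ) : ℚ) =
      ((n.choose u : ℕ) : ℚ) * (((n - u).choose (p - u) : ℕ) : ℚ) := by exact_mod_cast h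
  linarith [h']

/-- `Φ(p,q) = Σ_{q<u<p} C(p,u)/C(p+q−u,p−u)`. -/
lemma phiK_eq_sum_ratio (p q : ℕ) :
    phiK p q = ∑ u ∈ Finset.Ioo q p, ((p.choose u : ℕ) : ℚ) / (((p + q - u).choose (p - u) : ℕ) : ℚ) := by
  unfold phiK
  rw [Finset.sum_div]
  refine Finset.sum_congr rfl (fun u hu => ?_)
  rw [Finset.mem_Ioo] at hu
  exact choose_div_choose_eq (by omega) (by omega)

/-- `Σ_{u ∈ Ioo q p} f (u − 1) = f q + Σ_{v ∈ Ioo q (p − 1)} f v` for `1 ≤ q`, `q + 2 ≤ p`. -/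
lemma sum_Ioo_pred_eq' (f : ℕ → ℚ) {p q : ℕ} (hq : 1 ≤ q) (hpq : q + 2 ≤ p) :
    ∑ u ∈ Finset.Ioo q p, f (u - 1) = f q + ∑ v ∈ Finset.Ioo q (p - 1), f v := by
  have himg : Finset.Ioo q p = (Finset.Ioo (q - 1) (p - 1)).image (fun v => v + 1) := by
    ext u
    simp only [Finset.mem_Ioo, Finset.mem_image]
    constructor
    · intro hu
      exact ⟨u - 1, by omega, by omega⟩
    · rintro ⟨v, hv, rfl⟩
      omega
  rw [himg, Finset.sum_image (fun a _ b _ h => by omega)]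
  simp only [Nat.add_sub_cancel]
  have hsplit : Finset.Ioo (q - 1) (p - 1) = insert q (Finset.Ioo q (p - 1)) := by
    ext v
    simp only [Finset.mem_Ioo, Finset.mem_insert]
    omega
  rw [hsplit, Finset.sum_insert (by simp)]

/-- The reindexed Pascal part: `Σ_{q<u<p} C(p−1,u−1)/C(p+q−u,p−u) = 1 + Φ(p−1,q)`. -/
lemma sum_pascal_shift {p q : ℕ} (hq : 1 ≤ q) (hpq : q + 2 ≤ p) :
    ∑ u ∈ Finset.Ioo q p, (((p - 1).choose (u - 1) : ℕ) : ℚ) / (((p + q - u).choose (p - u) : ℕ) : ℚ) =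
      1 + phiK (p - 1) q := by
  -- rewrite the term as `g (u − 1)` with `g v = C(p−1,v)/C(p−1+q−v, p−1−v)`
  set g : ℕ → ℚ := fun v => (((p - 1).choose v : ℕ) : ℚ) / (((p - 1 + q - v).choose (p - 1 - v) : ℕ) : ℚ)
    with hg
  have hterm : ∀ u ∈ Finset.Ioo q p,
      (((p - 1).choose (u - 1) : ℕ) : ℚ) / (((p + q - u).choose (p - u) : ℕ) : ℚ) = g (u - 1) := by
    intro u hu
    rw [Finset.mem_Ioo] at hu
    simp only [hg]
    congr 3 <;> omega
  rw [Finset.sum_congr rfl hterm, sum_Ioo_pred_eq' g hq hpq]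
  have hgq : g q = 1 := by
    simp only [hg]
    have h1 : (p - 1 + q - q).choose (p - 1 - q) = (p - 1).choose q := by
      rw [show p - 1 + q - q = p - 1 by omega]
      exact Nat.choose_symm (by omega)
    rw [h1]
    have hpos : (0 : ℚ) < (((p - 1).choose q : ℕ) : ℚ) := by exact_mod_cast Nat.choose_pos (by omega)
    exact div_self hpos.ne'
  rw [hgq, phiK_eq_sum_ratio]

/-- **The weight identity**: `Σ_{q<u<p} C(p−1,u)/C(p+q−u,p−u) + (C(p−1,q) − 1)/C(p−1,q)
= Φ(p,q) − Φ(p−1,q) − 1/C(p−1,q)`. -/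
lemma weight_eq {p q : ℕ} (hq : 1 ≤ q) (hpq : q + 2 ≤ p) :
    ∑ u ∈ Finset.Ioo q p, (((p - 1).choose u : ℕ) : ℚ) / (((p + q - u).choose (p - u) : ℕ) : ℚ) +
        ((((p - 1).choose q : ℕ) : ℚ) - 1) / (((p - 1).choose q : ℕ) : ℚ) =
      phiK p q - phiK (p - 1) q - 1 / (((p - 1).choose q : ℕ) : ℚ) := by
  have hpascal : ∀ u ∈ Finset.Ioo q p,
      ((p.choose u : ℕ) : ℚ) / (((p + q - u).choose (p - u) : ℕ) : ℚ) =
        (((p - 1).choose u : ℕ) : ℚ) / (((p + q - u).choose (p - u) : ℕ) : ℚ) +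
          (((p - 1).choose (u - 1) : ℕ) : ℚ) / (((p + q - u).choose (p - u) : ℕ) : ℚ) := by
    intro u hu
    rw [Finset.mem_Ioo] at hu
    rw [← add_div]
    congr 1
    have h := Nat.choose_succ_succ' (p - 1) (u - 1)
    rw [show p - 1 + 1 = p by omega, show u - 1 + 1 = u by omega] at h
    rw [h]
    push_cast
    ring
  have hsum := phiK_eq_sum_ratio p q
  rw [Finset.sum_congr rfl hpascal, Finset.sum_add_distrib, sum_pascal_shift hq hpq] at hsum
  have hpos : (0 : ℚ) < (((p - 1).choose q : ℕ) : ℚ) := by exact_mod_cast Nat.choose_pos (by omega)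
  have hfrac : ((((p - 1).choose q : ℕ) : ℚ) - 1) / (((p - 1).choose q : ℕ) : ℚ) =
      1 - 1 / (((p - 1).choose q : ℕ) : ℚ) := by
    field_simp
  rw [hfrac]
  linarith [hsum]

/-- **Mine-2's exact form (R)**: `Φ(p,q)·(p + q) = (2Φ(p−1,q) + 2)·p` for `1 ≤ q`, `q + 2 ≤ p`. -/
lemma phiK_mul_eq {p q : ℕ} (hq : 1 ≤ q) (hpq : q + 2 ≤ p) :
    phiK p q * ((p + q : ℕ) : ℚ) = (2 * phiK (p - 1) q + 2) * (p : ℚ) := by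
  set n := p + q with hn
  -- Pascal on the numerator of `Φ(p,q)`
  have hpascal : ∀ u ∈ Finset.Ioo q p, ((n.choose u : ℕ) : ℚ) =
      (((n - 1).choose u : ℕ) : ℚ) + (((n - 1).choose (u - 1) : ℕ) : ℚ) := by
    intro u hu
    rw [Finset.mem_Ioo] at hu
    have h := Nat.choose_succ_succ' (n - 1) (u - 1)
    rw [show n - 1 + 1 = n by omega, show u - 1 + 1 = u by omega] at h
    rw [h]
    push_cast
    ring
  have hsplit : Finset.Ioo q p = insert (p - 1) (Finset.Ioo q (p - 1)) := by
    ext u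
    simp only [Finset.mem_Ioo, Finset.mem_insert]
    omega
  have hS1 : ∑ u ∈ Finset.Ioo q p, (((n - 1).choose u : ℕ) : ℚ) =
      ∑ u ∈ Finset.Ioo q (p - 1), (((n - 1).choose u : ℕ) : ℚ) + (((n - 1).choose (p - 1) : ℕ) : ℚ) := by
    rw [hsplit, Finset.sum_insert (by simp)]
    ring
  have hS2 : ∑ u ∈ Finset.Ioo q p, (((n - 1).choose (u - 1) : ℕ) : ℚ) =
      (((n - 1).choose q : ℕ) : ℚ) + ∑ v ∈ Finset.Ioo q (p - 1), (((n - 1).choose v : ℕ) : ℚ) :=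
    sum_Ioo_pred_eq' (fun v => (((n - 1).choose v : ℕ) : ℚ)) hq hpq
  have hsym : (n - 1).choose q = (n - 1).choose (p - 1) := by
    rw [show q = (n - 1) - (p - 1) by omega]
    exact Nat.choose_symm (by omega)
  -- `Φ(p−1,q)·C(n−1,p−1) = Σ_{q<v<p−1} C(n−1,v)`
  have hphi' : phiK (p - 1) q * (((n - 1).choose (p - 1) : ℕ) : ℚ) =
      ∑ v ∈ Finset.Ioo q (p - 1), (((n - 1).choose v : ℕ) : ℚ) := by
    unfold phiK
    rw [show p - 1 + q = n - 1 by omega]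
    have hpos : (0 : ℚ) < (((n - 1).choose (p - 1) : ℕ) : ℚ) := by
      exact_mod_cast Nat.choose_pos (by omega)
    rw [div_mul_cancel₀ _ hpos.ne']
  -- `n·C(n−1,p−1) = C(n,p)·p`
  have hrec : ((n : ℕ) : ℚ) * (((n - 1).choose (p - 1) : ℕ) : ℚ) = ((n.choose p : ℕ) : ℚ) * (p : ℚ) := by
    have h := Nat.add_one_mul_choose_eq (n - 1) (p - 1)
    rw [show n - 1 + 1 = n by omega, show p - 1 + 1 = p by omega] at h
    exact_mod_cast h
  have hpos : (0 : ℚ) < ((n.choose p : ℕ) : ℚ) := by exact_mod_cast Nat.choose_pos (by omega)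
  have hdef : phiK p q = (∑ u ∈ Finset.Ioo q p, ((n.choose u : ℕ) : ℚ)) / ((n.choose p : ℕ) : ℚ) := by
    unfold phiK
    rw [← hn]
  rw [hdef, Finset.sum_congr rfl hpascal, Finset.sum_add_distrib, hS1, hS2, hsym]
  rw [div_mul_eq_mul_div, div_eq_iff hpos.ne']
  linear_combination (2 * phiK (p - 1) q + 2) * hrec - (2 : ℚ) * ((n : ℕ) : ℚ) * hphi'

end PercRepro
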